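import Summits.ABC.IUTFork.Cor312SzpiroBadVsDepthPoint
import Summits.ABC.IUTFork.Repair.RHPlaceCutHeightCeiling
import HarnessLib

/-!
# R-W lane U, task T4 (sequel 2): the EXACT degree-form window criterion — `¬ Deep` ⟺ the TOP-LABEL inequality at every bad place over an
# odd prime; and its certified forms with `log_p N₀` for any kernel lower bound `N₀ ≤ [K:ℚ]`, in particular `N₀ := l`

PROOF-ONLY sequel (no `def`, no new `Prop`) of `Cor312SzpiroBadVsDepth.lean` (p457542) / `Cor312SzpiroBadVsDepthPoint.lean` (p458028),
seat abc-iut-w4-d078 g6, D-0079 R-W task T4 (`plan/W/WINDOW-SPEC.md` §2b).  TAKES NO SIDE on [IUTchIII] Cor. 3.12 or on any author.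

WHY.  p457542's `GenuineK.not_deepOrd_of_neg_ord_jE_le` certifies «in the window at every packet» from the UNIFORM bound `H_{x₀} ≤ 16·e_{x₀}`;
abc-iut-rw-num-lead (WINDOW-TABLE v3.8, 17:27:12Z) uses it for the HEX rows `k ≤ 8` and 30/37 Frey triples, but the tier-1 targets with a bad
place of height `v_p(abc) = 15, 19` (`H = 30, 38` over `ℚ`) exceed `16` and fall back to a numeric degree-form check.  The degree-form depth
locus is, however, EXACTLY decidable: the depth threshold at label `j = i+1` is `2l·e·((j+1)(4+2·log_p[K:ℚ])+1)/(j²−1)`, DECREASING in `j`, so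
only the top label `j = l⋆` matters, and abc-iut-rp-j2's `Repair.RHPlaceCutHeightCeiling.height_le_top_of_not_deepOrd` (p457321) is one
half of an IFF.  This file proves the other half and the iff:

* `GenuineK.one_le_depthProduct_of_topLabel_le` — one packet: the top-label inequality with ANY `L₀ ≤ L` (`L = log_p[K:ℚ]`) forces the
  degree-form product at EVERY label `i+1 ≤ l⋆` to be `≥ 1` (monotonicity in the label + in `L`);
* `GenuineK.not_deepOrd_of_topLabel_le_logb` — `¬DeepOrd(D)` from «at every bad `x₀ ∣ p > 2`:
  `((l⋆)²−1)·(−ord_{x₀}(j_E)) ≤ 2l·e_{x₀}·((l⋆+1)(4+2·log_p N₀)+1)`» for ANY real `1 ≤ N₀ ≤ [K:ℚ]` (a certified lower bound on the degree);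
* `GenuineK.not_deepOrd_of_topLabel_le` — the same with `N₀ := l` (AUTOMATIC: at a bad place `l ≤ e(x₀|p) ≤ [K:ℚ]`, abc-iut-w5-d054's
  `Cor312Prov.l_le_ramificationIdx_int_of_over_VFbad` + abc-iut-S1's `ramificationIdx_int_le_finrank_rat`);
* `GenuineK.not_deepOrd_iff_topLabel_le` — **`¬DeepOrd(D)` ⟺ the top-label inequality with `log_p[K:ℚ]` at every bad `x₀ ∣ p > 2`**
  (⟹ is p457321, ⟸ is the above at `N₀ := [K:ℚ]`); chosen-q-idele forms `…not_deep_iff_topLabel_le` / `…not_deep_of_topLabel_le`.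

READING for the window table (numbers, no side): with `N₀ = l` the certified window test at a place of `K` over `p` is
`((l⋆)²−1)·H ≤ 2l·e·((l⋆+1)(4+2·log_p l)+1)`; e.g. `l = 13`, `p = 3`, `e ≥ 1`: `35·H ≤ 26·(7·(4+2·log₃13)+1)·e ≈ 1604·e`, so `H = 30`
(`v₃(abc) = 15`) and `H = 38` (`v₃ = 19`) are IN THE WINDOW by a named decl; the bad place over `2` never enters (the depth locus reads
`p > 2` only).  Nothing here asserts the existence of any datum, nor `Cor312Of` for any datum; typed ≠ proved.
[cite: Mochizuki2012, IUTchIV Thm. 1.10 p. 22–23; IUTchI Def. 3.1 (b)(c) p. 61, Ex. 3.2 (iv) p. 71] [cite: DupuyHilado2025, §3.3, §3.4]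
[claim: Mochizuki2012, status: disputed]
-/

noncomputable section

open Set Function NumberField IsDedekindDomain

namespace Summit.ABC.IUTFork.Conditional

open Thm311 Thm311.Real Cor312 Cor312Vol Cor312Prov Literature.IUT.LogThetaLattice Literature.IUT.LogVolume
  Literature.IUT.HodgeTheaters Literature.IUT.LogVolume.ThetaData
open Literature.NumberTheory.DiophantineGeometry.GenEll Summit.ABC.ABC.Theorems
open Summit.ABC.IUTFork.Repair.RHPlaceCutHeightCeiling (height_le_top_of_not_deepOrd)

/-! ## §1. One packet: the top-label inequality dominates every label -/

/-- **One packet, exact form.**  For `p > 1`, `0 ≤ L₀ ≤ L`, `e > 0`, `o ∈ ℤ`, `m ≥ 2` («`l⋆`»), a label index `i` with `i + 1 ≤ m`, and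
`lN = 2m+1` («`l`»): if the TOP-LABEL inequality `(m²−1)·(−o) ≤ 2·lN·e·((m+1)(4+2L₀)+1)` holds, then the degree-form product at label `i`,
`p^{((i+2)(4+2L))+1}·(p^{o/(2·lN·e)})^{(i+1)²−1}`, is `≥ 1`.  (With `j = i+1`: `((m+1)B₀+1)(j²−1) ≤ ((j+1)B₀+1)(m²−1)` for `j ≤ m`, the
difference being `(m−j)(B₀(m+1)(j+1) + m + j)`, and `B₀ = 4+2L₀ ≤ 4+2L`.) [folklore] -/
theorem GenuineK.one_le_depthProduct_of_topLabel_le {p L L₀ e : ℝ} {o : ℤ} {i m lN : ℕ} (hp : 1 < p) (hL₀ : 0 ≤ L₀) (hL : L₀ ≤ L)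
    (he : 0 < e) (hm : 2 ≤ m) (hi : i + 1 ≤ m) (hl : lN = 2 * m + 1)
    (ho : ((((m : ℕ) : ℝ)) ^ 2 - 1) * (-(o : ℝ)) ≤ 2 * (lN : ℝ) * e * ((((m : ℕ) : ℝ) + 1) * (4 + 2 * L₀) + 1)) :
    1 ≤ p ^ ((((i : ℕ) : ℝ) + 2) * (4 + 2 * L) + 1) * (p ^ ((o : ℝ) / (2 * (lN : ℝ) * e))) ^ (((i : ℕ) + 1) ^ 2 - 1) := by
  have hp0 : 0 < p := by linarith
  have hmR : (2 : ℝ) ≤ (m : ℝ) := by exact_mod_cast hm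
  have hiR : (i : ℝ) + 1 ≤ (m : ℝ) := by exact_mod_cast hi
  have hi0 : (0 : ℝ) ≤ (i : ℝ) := Nat.cast_nonneg _
  have hlR : (lN : ℝ) = 2 * (m : ℝ) + 1 := by rw [hl]; push_cast; ring
  have hd : (0 : ℝ) < 2 * (lN : ℝ) * e := by rw [hlR]; positivity
  -- the natural-number exponent as a real number
  have hn : ((((i : ℕ) + 1) ^ 2 - 1 : ℕ) : ℝ) = ((i : ℝ) + 1) ^ 2 - 1 := by
    rw [Nat.cast_sub (Nat.one_le_pow _ _ (Nat.succ_pos _))]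
    push_cast
    ring
  have hn0 : (0 : ℝ) ≤ ((i : ℝ) + 1) ^ 2 - 1 := by nlinarith
  -- rewrite the product as ONE real power and reduce to the sign of the exponent
  rw [← Real.rpow_natCast (p ^ ((o : ℝ) / (2 * (lN : ℝ) * e))) (((i : ℕ) + 1) ^ 2 - 1),
    ← Real.rpow_mul hp0.le, ← Real.rpow_add hp0, hn]
  refine Real.one_le_rpow hp.le ?_
  -- exponent = (d·A + n·o)/d with d = 2·lN·e > 0
  have hA0 : (0 : ℝ) ≤ (((i : ℕ) : ℝ) + 2) * (4 + 2 * L) + 1 := by nlinarith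
  have key : (-(o : ℝ)) * (((i : ℝ) + 1) ^ 2 - 1) ≤ 2 * (lN : ℝ) * e * ((((i : ℕ) : ℝ) + 2) * (4 + 2 * L) + 1) := by
    rcases le_or_gt (-(o : ℝ)) 0 with hneg | hpos
    · -- `−o ≤ 0`: the left side is `≤ 0 ≤` the right side
      have : (-(o : ℝ)) * (((i : ℝ) + 1) ^ 2 - 1) ≤ 0 := mul_nonpos_of_nonpos_of_nonneg hneg hn0
      nlinarith [mul_nonneg hd.le hA0]
    · -- `−o > 0`: chain through the top label
      have hm21 : (0 : ℝ) < ((m : ℝ)) ^ 2 - 1 := by nlinarith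
      -- (1) `ho` times `n ≥ 0`
      have h1 : ((((m : ℕ) : ℝ)) ^ 2 - 1) * (-(o : ℝ)) * (((i : ℝ) + 1) ^ 2 - 1) ≤
          2 * (lN : ℝ) * e * ((((m : ℕ) : ℝ) + 1) * (4 + 2 * L₀) + 1) * (((i : ℝ) + 1) ^ 2 - 1) :=
        mul_le_mul_of_nonneg_right ho hn0
      -- (2) monotonicity in the label: `((m+1)B₀+1)(j²−1) ≤ ((j+1)B₀+1)(m²−1)`, `j = i+1 ≤ m`
      have hB₀ : (0 : ℝ) ≤ 4 + 2 * L₀ := by linarith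
      have hmj : (0 : ℝ) ≤ (m : ℝ) - ((i : ℝ) + 1) := by linarith
      have h2 : ((((m : ℕ) : ℝ) + 1) * (4 + 2 * L₀) + 1) * (((i : ℝ) + 1) ^ 2 - 1) ≤
          ((((i : ℕ) : ℝ) + 2) * (4 + 2 * L₀) + 1) * (((m : ℝ)) ^ 2 - 1) := by
        nlinarith [mul_nonneg hmj (by positivity : (0 : ℝ) ≤ (4 + 2 * L₀) * ((m : ℝ) + 1) * ((i : ℝ) + 2) + ((m : ℝ) + ((i : ℝ) + 1)))]
      -- (3) monotonicity in `L`: `(j+1)(4+2L₀)+1 ≤ (j+1)(4+2L)+1`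
      have h3 : ((((i : ℕ) : ℝ) + 2) * (4 + 2 * L₀) + 1) * (((m : ℝ)) ^ 2 - 1) ≤
          ((((i : ℕ) : ℝ) + 2) * (4 + 2 * L) + 1) * (((m : ℝ)) ^ 2 - 1) := by
        apply mul_le_mul_of_nonneg_right _ hm21.le
        nlinarith
      -- assemble: `(−o)·n·(m²−1) ≤ d·A·(m²−1)`, then cancel `m²−1 > 0`
      have h4 : (-(o : ℝ)) * (((i : ℝ) + 1) ^ 2 - 1) * (((m : ℝ)) ^ 2 - 1) ≤
          2 * (lN : ℝ) * e * ((((i : ℕ) : ℝ) + 2) * (4 + 2 * L) + 1) * (((m : ℝ)) ^ 2 - 1) := by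
        have h23 := mul_le_mul_of_nonneg_left (h2.trans h3) hd.le
        nlinarith [h1, h23]
      exact le_of_mul_le_mul_right h4 hm21
  have hexp : ((((i : ℕ) : ℝ) + 2) * (4 + 2 * L) + 1) + (o : ℝ) / (2 * (lN : ℝ) * e) * (((i : ℝ) + 1) ^ 2 - 1) =
      (2 * (lN : ℝ) * e * ((((i : ℕ) : ℝ) + 2) * (4 + 2 * L) + 1) + (o : ℝ) * (((i : ℝ) + 1) ^ 2 - 1)) / (2 * (lN : ℝ) * e) := by
    have hlN0 : (lN : ℝ) ≠ 0 := by rw [hlR]; positivity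
    have he0 : e ≠ 0 := he.ne'
    field_simp
  rw [hexp]
  exact div_nonneg (by linarith) hd.le

variable {F K Fbar : Type} [Field F] [NumberField F] [Field K] [NumberField K] [Algebra F K] [Field Fbar]
  [Algebra F Fbar] [Algebra K Fbar] {E : WeierstrassCurve F} [E.IsElliptic] {l : ℕ} {Pb : BadPlacePredicates K}
  (D : InitialThetaData F K Fbar E l Pb)

/-! ## §2. The window criterion with a certified lower bound `N₀ ≤ [K:ℚ]` -/

/-- **Exact window criterion, parametric in a certified degree bound.**  For an initial Θ-datum `D` over `K` and ANY real `N₀` with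
`1 ≤ N₀ ≤ [K:ℚ]`: if every bad place `x₀` of `K` over an odd prime `p` satisfies the TOP-LABEL inequality
`((l⋆)²−1)·(−ord_{x₀}(j_E)) ≤ 2l·e_{x₀}·((l⋆+1)(4+2·log_p N₀)+1)`, then `¬DeepOrd(D)` (the right-hand side of abc-iut-C-cert-2's
`GenuineK.deep_iff_deepOrd`, VERBATIM): no packet `(p > 2, i, x₀)` is on the degree-form depth locus.  (`log_p N₀ ≤ log_p[K:ℚ]` only lowers the
bar; the top label dominates every label by `one_le_depthProduct_of_topLabel_le`.) [claim: Mochizuki2012, status: disputed]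
[cite: Mochizuki2012, IUTchIV Thm. 1.10 p. 22–23] [cite: DupuyHilado2025, §3.4] -/
theorem GenuineK.not_deepOrd_of_topLabel_le_logb {N₀ : ℝ} (hN₀ : 1 ≤ N₀) (hN : N₀ ≤ (Module.finrank ℚ K : ℝ))
    (htop : ∀ (pp : Nat.Primes) (x₀ : (thetaIndex (pilotDataOfK D K)).Fibre (.inr pp)), 2 < (pp : ℕ) →
      haveI : Fact (pp : ℕ).Prime := ⟨pp.2⟩
      placeOf (pilotDataOfK D K) pp.1 x₀ ∈ (pilotDataOfK D K).S →
        ((((pilotDataOfK D K).lstar : ℝ)) ^ 2 - 1) * -((ord K (placeOf (pilotDataOfK D K) pp.1 x₀) (algebraMap F K E.j) : ℤ) : ℝ) ≤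
          (2 * l * ramIdx K (placeOf (pilotDataOfK D K) pp.1 x₀) : ℝ) *
            ((((pilotDataOfK D K).lstar : ℝ) + 1) * (4 + 2 * Real.logb (pp : ℕ) N₀) + 1)) :
    ¬ (∃ (pp : Nat.Primes) (_ : 2 < (pp : ℕ)) (i : Fin (thetaIndex (pilotDataOfK D K)).lstar)
        (x₀ : (thetaIndex (pilotDataOfK D K)).Fibre (.inr pp)),
      haveI : Fact (pp : ℕ).Prime := ⟨pp.2⟩
      placeOf (pilotDataOfK D K) pp.1 x₀ ∈ (pilotDataOfK D K).S ∧
      ((pp : ℕ) : ℝ) ^ ((((i : ℕ) : ℝ) + 2) * (4 + 2 * Real.logb (pp : ℕ) (Module.finrank ℚ K)) + 1) *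
        (((pp : ℕ) : ℝ) ^ ((ord K (placeOf (pilotDataOfK D K) pp.1 x₀) (algebraMap F K E.j) : ℝ) /
          (2 * l * ramIdx K (placeOf (pilotDataOfK D K) pp.1 x₀)))) ^ (((i : ℕ) + 1) ^ 2 - 1) < 1) := by
  rintro ⟨pp, hp2, i, x₀, hS, hlt⟩
  haveI : Fact (pp : ℕ).Prime := ⟨pp.2⟩
  have hp1 : (1 : ℝ) < ((pp : ℕ) : ℝ) := by exact_mod_cast pp.2.one_lt
  have hL₀ : 0 ≤ Real.logb (pp : ℕ) N₀ := Real.logb_nonneg hp1 hN₀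
  have hL : Real.logb (pp : ℕ) N₀ ≤ Real.logb (pp : ℕ) (Module.finrank ℚ K) :=
    Real.logb_le_logb_of_le hp1 (by linarith) hN
  have he : (0 : ℝ) < (ramIdx K (placeOf (pilotDataOfK D K) pp.1 x₀) : ℝ) := by
    exact_mod_cast Nat.pos_of_ne_zero (ramIdx_ne_zero K _)
  have hm : 2 ≤ (pilotDataOfK D K).lstar := (pilotDataOfK D K).two_le_lstar
  have hi : (i : ℕ) + 1 ≤ (pilotDataOfK D K).lstar := Nat.succ_le_of_lt i.2
  have hl : l = 2 * (pilotDataOfK D K).lstar + 1 := (pilotDataOfK D K).l_eq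
  have h1 := GenuineK.one_le_depthProduct_of_topLabel_le (o := ord K (placeOf (pilotDataOfK D K) pp.1 x₀) (algebraMap F K E.j))
    hp1 hL₀ hL he hm hi hl (by
      have h := htop pp x₀ hp2 hS
      exact_mod_cast h)
  exact absurd hlt (not_lt.mpr h1)

/-- `l ≤ [K:ℚ]` as soon as the `K`-level pilot datum OF `D` has a bad place `w`: `l ≤ e(w|p)` ([IUTchI] Ex. 3.2 (iv); abc-iut-w5-d054's
`Cor312Prov.l_le_ramificationIdx_int_of_over_VFbad`) and `e(w|p) ≤ [K:ℚ]` (abc-iut-S1's `ramificationIdx_int_le_finrank_rat`).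
[cite: Mochizuki2012, IUTchI Ex. 3.2 (iv) p. 71] [cite: NeukirchANT1999, Ch. I §8 Prop. (8.2)] -/
theorem GenuineK.l_le_finrank_rat_of_mem_S {w : HeightOneSpectrum (𝓞 K)} (hS : w ∈ (pilotDataOfK D K).S) :
    l ≤ Module.finrank ℚ K :=
  (l_le_ramificationIdx_int_of_over_VFbad D w ((mem_pilotDataOfK_S_iff D K w).mp hS)).trans
    (ramificationIdx_int_le_finrank_rat (F₀ := K) w)

/-- **Exact window criterion with the automatic bound `N₀ := l`.**  If every bad place `x₀` of `K` over an odd prime `p` satisfies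
`((l⋆)²−1)·(−ord_{x₀}(j_E)) ≤ 2l·e_{x₀}·((l⋆+1)(4+2·log_p l)+1)`, then `¬DeepOrd(D)` — no certified degree bound is needed beyond `l ≤ [K:ℚ]`,
which holds at any bad place (`l_le_finrank_rat_of_mem_S`).  E.g. `l = 13`, `p = 3`: the test reads `35·H ≤ 26·(7·(4+2·log₃13)+1)·e`
(`≈ 1604·e`). [claim: Mochizuki2012, status: disputed] [cite: Mochizuki2012, IUTchIV Thm. 1.10 p. 22–23; IUTchI Ex. 3.2 (iv) p. 71] -/
theorem GenuineK.not_deepOrd_of_topLabel_le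
    (htop : ∀ (pp : Nat.Primes) (x₀ : (thetaIndex (pilotDataOfK D K)).Fibre (.inr pp)), 2 < (pp : ℕ) →
      haveI : Fact (pp : ℕ).Prime := ⟨pp.2⟩
      placeOf (pilotDataOfK D K) pp.1 x₀ ∈ (pilotDataOfK D K).S →
        ((((pilotDataOfK D K).lstar : ℝ)) ^ 2 - 1) * -((ord K (placeOf (pilotDataOfK D K) pp.1 x₀) (algebraMap F K E.j) : ℤ) : ℝ) ≤
          (2 * l * ramIdx K (placeOf (pilotDataOfK D K) pp.1 x₀) : ℝ) *
            ((((pilotDataOfK D K).lstar : ℝ) + 1) * (4 + 2 * Real.logb (pp : ℕ) (l : ℕ)) + 1)) :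
    ¬ (∃ (pp : Nat.Primes) (_ : 2 < (pp : ℕ)) (i : Fin (thetaIndex (pilotDataOfK D K)).lstar)
        (x₀ : (thetaIndex (pilotDataOfK D K)).Fibre (.inr pp)),
      haveI : Fact (pp : ℕ).Prime := ⟨pp.2⟩
      placeOf (pilotDataOfK D K) pp.1 x₀ ∈ (pilotDataOfK D K).S ∧
      ((pp : ℕ) : ℝ) ^ ((((i : ℕ) : ℝ) + 2) * (4 + 2 * Real.logb (pp : ℕ) (Module.finrank ℚ K)) + 1) *
        (((pp : ℕ) : ℝ) ^ ((ord K (placeOf (pilotDataOfK D K) pp.1 x₀) (algebraMap F K E.j) : ℝ) /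
          (2 * l * ramIdx K (placeOf (pilotDataOfK D K) pp.1 x₀)))) ^ (((i : ℕ) + 1) ^ 2 - 1) < 1) := by
  intro h
  have h' := h
  obtain ⟨pp, hp2, i, x₀, hS, -⟩ := h'
  have h5 : 5 ≤ l := D.five_le_l
  have hN₀ : (1 : ℝ) ≤ ((l : ℕ) : ℝ) := by exact_mod_cast (show 1 ≤ l by omega)
  have hN : (((l : ℕ) : ℝ)) ≤ (Module.finrank ℚ K : ℝ) := by
    exact_mod_cast GenuineK.l_le_finrank_rat_of_mem_S D (by exact hS)
  exact GenuineK.not_deepOrd_of_topLabel_le_logb D hN₀ hN htop h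

/-! ## §3. The iff, and the chosen-q-idele forms -/

/-- **`¬DeepOrd` ⟺ TOP-LABEL inequality at every bad place over an odd prime** (exact characterisation of the degree-form window): `⟹` is
abc-iut-rp-j2's `Repair.RHPlaceCutHeightCeiling.height_le_top_of_not_deepOrd` (p457321), `⟸` is `not_deepOrd_of_topLabel_le_logb` at
`N₀ := [K:ℚ]`. [claim: Mochizuki2012, status: disputed] [cite: DupuyHilado2025, §3.3, §3.4] -/
theorem GenuineK.not_deepOrd_iff_topLabel_le :
    (¬ (∃ (pp : Nat.Primes) (_ : 2 < (pp : ℕ)) (i : Fin (thetaIndex (pilotDataOfK D K)).lstar)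
        (x₀ : (thetaIndex (pilotDataOfK D K)).Fibre (.inr pp)),
      haveI : Fact (pp : ℕ).Prime := ⟨pp.2⟩
      placeOf (pilotDataOfK D K) pp.1 x₀ ∈ (pilotDataOfK D K).S ∧
      ((pp : ℕ) : ℝ) ^ ((((i : ℕ) : ℝ) + 2) * (4 + 2 * Real.logb (pp : ℕ) (Module.finrank ℚ K)) + 1) *
        (((pp : ℕ) : ℝ) ^ ((ord K (placeOf (pilotDataOfK D K) pp.1 x₀) (algebraMap F K E.j) : ℝ) /
          (2 * l * ramIdx K (placeOf (pilotDataOfK D K) pp.1 x₀)))) ^ (((i : ℕ) + 1) ^ 2 - 1) < 1)) ↔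
    ∀ (pp : Nat.Primes) (x₀ : (thetaIndex (pilotDataOfK D K)).Fibre (.inr pp)), 2 < (pp : ℕ) →
      haveI : Fact (pp : ℕ).Prime := ⟨pp.2⟩
      placeOf (pilotDataOfK D K) pp.1 x₀ ∈ (pilotDataOfK D K).S →
        ((((pilotDataOfK D K).lstar : ℝ)) ^ 2 - 1) * -((ord K (placeOf (pilotDataOfK D K) pp.1 x₀) (algebraMap F K E.j) : ℤ) : ℝ) ≤
          (2 * l * ramIdx K (placeOf (pilotDataOfK D K) pp.1 x₀) : ℝ) *
            ((((pilotDataOfK D K).lstar : ℝ) + 1) * (4 + 2 * Real.logb (pp : ℕ) (Module.finrank ℚ K)) + 1) := by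
  constructor
  · intro hnd pp x₀ hp2 hS
    exact height_le_top_of_not_deepOrd D hnd pp hp2 x₀ hS
  · intro htop
    have hN₀ : (1 : ℝ) ≤ (Module.finrank ℚ K : ℝ) := by exact_mod_cast Module.finrank_pos
    exact GenuineK.not_deepOrd_of_topLabel_le_logb D hN₀ le_rfl htop

/-- **Chosen-q-idele form of the iff** (the `Deep` of abc-iut-C-cert-1's and C-cert-3's v8K/v10K window certificates, via `GenuineK.deep_iff_deepOrd`).
[claim: Mochizuki2012, status: disputed] [cite: DupuyHilado2025, §3.4] -/
theorem GenuineK.not_deep_iff_topLabel_le :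
    (¬ (∃ (pp : Nat.Primes) (_ : 2 < (pp : ℕ)) (i : Fin (thetaIndex (pilotDataOfK D K)).lstar)
        (x₀ : (thetaIndex (pilotDataOfK D K)).Fibre (.inr pp)),
      haveI : Fact (pp : ℕ).Prime := ⟨pp.2⟩
      ((pp : ℕ) : ℝ) ^ ((((i : ℕ) : ℝ) + 2) * (4 + 2 * Real.logb (pp : ℕ) (Module.finrank ℚ K)) + 1) *
        ‖(exists_realising_qIdeles_pilotDataOfK D).choose pp x₀‖ ^ (((i : ℕ) + 1) ^ 2 - 1) < 1)) ↔
    ∀ (pp : Nat.Primes) (x₀ : (thetaIndex (pilotDataOfK D K)).Fibre (.inr pp)), 2 < (pp : ℕ) →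
      haveI : Fact (pp : ℕ).Prime := ⟨pp.2⟩
      placeOf (pilotDataOfK D K) pp.1 x₀ ∈ (pilotDataOfK D K).S →
        ((((pilotDataOfK D K).lstar : ℝ)) ^ 2 - 1) * -((ord K (placeOf (pilotDataOfK D K) pp.1 x₀) (algebraMap F K E.j) : ℤ) : ℝ) ≤
          (2 * l * ramIdx K (placeOf (pilotDataOfK D K) pp.1 x₀) : ℝ) *
            ((((pilotDataOfK D K).lstar : ℝ) + 1) * (4 + 2 * Real.logb (pp : ℕ) (Module.finrank ℚ K)) + 1) := by
  rw [← GenuineK.not_deepOrd_iff_topLabel_le D, not_iff_not]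
  exact GenuineK.deep_iff_deepOrd D

/-- **Chosen-q-idele form with `N₀ := l`**: the top-label inequality with `log_p l` at every bad `x₀ ∣ p > 2` puts the datum in the window of the
v8K/v10K certificates (the `¬Deep` conjunct of `hSHwBad` in p450130 holds). [claim: Mochizuki2012, status: disputed]
[cite: Mochizuki2012, IUTchIII Cor. 3.12 p. 173–174; IUTchIV Thm. 1.10 p. 22–23] -/
theorem GenuineK.not_deep_of_topLabel_le
    (htop : ∀ (pp : Nat.Primes) (x₀ : (thetaIndex (pilotDataOfK D K)).Fibre (.inr pp)), 2 < (pp : ℕ) →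
      haveI : Fact (pp : ℕ).Prime := ⟨pp.2⟩
      placeOf (pilotDataOfK D K) pp.1 x₀ ∈ (pilotDataOfK D K).S →
        ((((pilotDataOfK D K).lstar : ℝ)) ^ 2 - 1) * -((ord K (placeOf (pilotDataOfK D K) pp.1 x₀) (algebraMap F K E.j) : ℤ) : ℝ) ≤
          (2 * l * ramIdx K (placeOf (pilotDataOfK D K) pp.1 x₀) : ℝ) *
            ((((pilotDataOfK D K).lstar : ℝ) + 1) * (4 + 2 * Real.logb (pp : ℕ) (l : ℕ)) + 1)) :
    ¬ (∃ (pp : Nat.Primes) (_ : 2 < (pp : ℕ)) (i : Fin (thetaIndex (pilotDataOfK D K)).lstar)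
        (x₀ : (thetaIndex (pilotDataOfK D K)).Fibre (.inr pp)),
      haveI : Fact (pp : ℕ).Prime := ⟨pp.2⟩
      ((pp : ℕ) : ℝ) ^ ((((i : ℕ) : ℝ) + 2) * (4 + 2 * Real.logb (pp : ℕ) (Module.finrank ℚ K)) + 1) *
        ‖(exists_realising_qIdeles_pilotDataOfK D).choose pp x₀‖ ^ (((i : ℕ) + 1) ^ 2 - 1) < 1) :=
  fun h => GenuineK.not_deepOrd_of_topLabel_le D htop ((GenuineK.deep_iff_deepOrd D).mp h)


/-! ## §4. (v2, append-only) The place-dependent bound `N₀(x₀) := n_{x₀} = e_{x₀}·f_{x₀}` — the table's own local degree -/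

/-- `n_w = e_w·f_w ≤ [K:ℚ]` for a place `w` of `K` over `p` (one term of the fundamental identity `Σ_{w ∣ p} n_w = [K:ℚ]`, abc-iut-c312-3's
`sum_localDegree`). [cite: NeukirchANT1999, Ch. I §8 Prop. (8.2)] -/
theorem GenuineK.localDegree_le_finrank_rat (p : ℕ) [Fact p.Prime] {w : HeightOneSpectrum (𝓞 K)} (hw : w ∈ placesOver K p) :
    localDegree K w ≤ Module.finrank ℚ K := by
  rw [← sum_localDegree K p]
  exact Finset.single_le_sum (fun v _ => Nat.zero_le (localDegree K v)) hw

/-- **Exact window criterion with the PLACE-DEPENDENT certified bound `N₀(x₀) := n_{x₀} = e_{x₀}·f_{x₀}`** (the local degree, a column of the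
window table; `n_{x₀} ≤ [K:ℚ]` by `localDegree_le_finrank_rat`, `n_{x₀} ≥ e_{x₀} ≥ l` at a bad place): if every bad place `x₀` of `K` over an odd
prime `p` satisfies `((l⋆)²−1)·(−ord_{x₀}(j_E)) ≤ 2l·e_{x₀}·((l⋆+1)(4+2·log_p n_{x₀})+1)`, then `¬DeepOrd(D)`.  Sharper than the `N₀ := l` form
wherever `n_{x₀} > l` (e.g. `e_{x₀} = 30·l`). [claim: Mochizuki2012, status: disputed]
[cite: Mochizuki2012, IUTchIV Thm. 1.10 p. 22–23] [cite: DupuyHilado2025, §3.4, §3.6] -/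
theorem GenuineK.not_deepOrd_of_topLabel_le_localDegree
    (htop : ∀ (pp : Nat.Primes) (x₀ : (thetaIndex (pilotDataOfK D K)).Fibre (.inr pp)), 2 < (pp : ℕ) →
      haveI : Fact (pp : ℕ).Prime := ⟨pp.2⟩
      placeOf (pilotDataOfK D K) pp.1 x₀ ∈ (pilotDataOfK D K).S →
        ((((pilotDataOfK D K).lstar : ℝ)) ^ 2 - 1) * -((ord K (placeOf (pilotDataOfK D K) pp.1 x₀) (algebraMap F K E.j) : ℤ) : ℝ) ≤
          (2 * l * ramIdx K (placeOf (pilotDataOfK D K) pp.1 x₀) : ℝ) *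
            ((((pilotDataOfK D K).lstar : ℝ) + 1) *
              (4 + 2 * Real.logb (pp : ℕ) (localDegree K (placeOf (pilotDataOfK D K) pp.1 x₀) : ℕ)) + 1)) :
    ¬ (∃ (pp : Nat.Primes) (_ : 2 < (pp : ℕ)) (i : Fin (thetaIndex (pilotDataOfK D K)).lstar)
        (x₀ : (thetaIndex (pilotDataOfK D K)).Fibre (.inr pp)),
      haveI : Fact (pp : ℕ).Prime := ⟨pp.2⟩
      placeOf (pilotDataOfK D K) pp.1 x₀ ∈ (pilotDataOfK D K).S ∧
      ((pp : ℕ) : ℝ) ^ ((((i : ℕ) : ℝ) + 2) * (4 + 2 * Real.logb (pp : ℕ) (Module.finrank ℚ K)) + 1) *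
        (((pp : ℕ) : ℝ) ^ ((ord K (placeOf (pilotDataOfK D K) pp.1 x₀) (algebraMap F K E.j) : ℝ) /
          (2 * l * ramIdx K (placeOf (pilotDataOfK D K) pp.1 x₀)))) ^ (((i : ℕ) + 1) ^ 2 - 1) < 1) := by
  rintro ⟨pp, hp2, i, x₀, hS, hlt⟩
  haveI : Fact (pp : ℕ).Prime := ⟨pp.2⟩
  have hp1 : (1 : ℝ) < ((pp : ℕ) : ℝ) := by exact_mod_cast pp.2.one_lt
  have hN₀ : (1 : ℝ) ≤ ((localDegree K (placeOf (pilotDataOfK D K) pp.1 x₀) : ℕ) : ℝ) := by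
    exact_mod_cast localDegree_pos K _
  have hN : ((localDegree K (placeOf (pilotDataOfK D K) pp.1 x₀) : ℕ) : ℝ) ≤ (Module.finrank ℚ K : ℝ) := by
    exact_mod_cast GenuineK.localDegree_le_finrank_rat (K := K) pp.1 (placeOf_mem (pilotDataOfK D K) pp.1 x₀)
  have hL₀ : 0 ≤ Real.logb (pp : ℕ) ((localDegree K (placeOf (pilotDataOfK D K) pp.1 x₀) : ℕ) : ℝ) := Real.logb_nonneg hp1 hN₀
  have hL : Real.logb (pp : ℕ) ((localDegree K (placeOf (pilotDataOfK D K) pp.1 x₀) : ℕ) : ℝ) ≤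
      Real.logb (pp : ℕ) (Module.finrank ℚ K) :=
    Real.logb_le_logb_of_le hp1 (by linarith) hN
  have he : (0 : ℝ) < (ramIdx K (placeOf (pilotDataOfK D K) pp.1 x₀) : ℝ) := by
    exact_mod_cast Nat.pos_of_ne_zero (ramIdx_ne_zero K _)
  have hm : 2 ≤ (pilotDataOfK D K).lstar := (pilotDataOfK D K).two_le_lstar
  have hi : (i : ℕ) + 1 ≤ (pilotDataOfK D K).lstar := Nat.succ_le_of_lt i.2
  have hl : l = 2 * (pilotDataOfK D K).lstar + 1 := (pilotDataOfK D K).l_eq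
  have h1 := GenuineK.one_le_depthProduct_of_topLabel_le (o := ord K (placeOf (pilotDataOfK D K) pp.1 x₀) (algebraMap F K E.j))
    hp1 hL₀ hL he hm hi hl (by
      have h := htop pp x₀ hp2 hS
      exact_mod_cast h)
  exact absurd hlt (not_lt.mpr h1)

/-- Chosen-q-idele form of `not_deepOrd_of_topLabel_le_localDegree` (the `¬Deep` conjunct of `hSHwBad`, p450130).
[claim: Mochizuki2012, status: disputed] [cite: DupuyHilado2025, §3.4] -/
theorem GenuineK.not_deep_of_topLabel_le_localDegree
    (htop : ∀ (pp : Nat.Primes) (x₀ : (thetaIndex (pilotDataOfK D K)).Fibre (.inr pp)), 2 < (pp : ℕ) →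
      haveI : Fact (pp : ℕ).Prime := ⟨pp.2⟩
      placeOf (pilotDataOfK D K) pp.1 x₀ ∈ (pilotDataOfK D K).S →
        ((((pilotDataOfK D K).lstar : ℝ)) ^ 2 - 1) * -((ord K (placeOf (pilotDataOfK D K) pp.1 x₀) (algebraMap F K E.j) : ℤ) : ℝ) ≤
          (2 * l * ramIdx K (placeOf (pilotDataOfK D K) pp.1 x₀) : ℝ) *
            ((((pilotDataOfK D K).lstar : ℝ) + 1) *
              (4 + 2 * Real.logb (pp : ℕ) (localDegree K (placeOf (pilotDataOfK D K) pp.1 x₀) : ℕ)) + 1)) :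
    ¬ (∃ (pp : Nat.Primes) (_ : 2 < (pp : ℕ)) (i : Fin (thetaIndex (pilotDataOfK D K)).lstar)
        (x₀ : (thetaIndex (pilotDataOfK D K)).Fibre (.inr pp)),
      haveI : Fact (pp : ℕ).Prime := ⟨pp.2⟩
      ((pp : ℕ) : ℝ) ^ ((((i : ℕ) : ℝ) + 2) * (4 + 2 * Real.logb (pp : ℕ) (Module.finrank ℚ K)) + 1) *
        ‖(exists_realising_qIdeles_pilotDataOfK D).choose pp x₀‖ ^ (((i : ℕ) + 1) ^ 2 - 1) < 1) :=
  fun h => GenuineK.not_deepOrd_of_topLabel_le_localDegree D htop ((GenuineK.deep_iff_deepOrd D).mp h)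


/-! ## §5. (v3, append-only) The DEEP side certified from an UPPER bound `[K:ℚ] ≤ N₁` — the strict top-label inequality puts a datum ON the locus -/

/-- **DEEP-side decider, parametric in a certified degree bound `[K:ℚ] ≤ N₁`.**  If SOME bad place `x₀` of `K` over an odd prime `p` satisfies
the STRICT top-label inequality `2l·e_{x₀}·((l⋆+1)(4+2·log_p N₁)+1) < ((l⋆)²−1)·(−ord_{x₀}(j_E))` for a real `N₁ ≥ [K:ℚ]` (e.g. the S-chain bounds
`finrank_rat_K_le*` of `GenuineTowerDegreeBounds`), then `DeepOrd(D)` HOLDS — the witness is the top-label cell `(p, l⋆, x₀)`, via abc-iut-rp-j2's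
`deepCell_iff_height_gt` (p457321) and `log_p[K:ℚ] ≤ log_p N₁`.  Together with §2–§4 the table decides the degree-form depth locus from BOTH sides
by named decls: OFF ⟸ `N₀ ≤ [K:ℚ]` forms, ON ⟸ `[K:ℚ] ≤ N₁` forms; the exact iff (§3) sits between. [claim: Mochizuki2012, status: disputed]
[cite: Mochizuki2012, IUTchIV Thm. 1.10 p. 22–23] [cite: DupuyHilado2025, §3.3, §3.4] -/
theorem GenuineK.deepOrd_of_topLabel_gt_logb {N₁ : ℝ} (hN : (Module.finrank ℚ K : ℝ) ≤ N₁)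
    (h : ∃ (pp : Nat.Primes) (_ : 2 < (pp : ℕ)) (x₀ : (thetaIndex (pilotDataOfK D K)).Fibre (.inr pp)),
      haveI : Fact (pp : ℕ).Prime := ⟨pp.2⟩
      placeOf (pilotDataOfK D K) pp.1 x₀ ∈ (pilotDataOfK D K).S ∧
        (2 * l * ramIdx K (placeOf (pilotDataOfK D K) pp.1 x₀) : ℝ) *
            ((((pilotDataOfK D K).lstar : ℝ) + 1) * (4 + 2 * Real.logb (pp : ℕ) N₁) + 1) <
          ((((pilotDataOfK D K).lstar : ℝ)) ^ 2 - 1) * -((ord K (placeOf (pilotDataOfK D K) pp.1 x₀) (algebraMap F K E.j) : ℤ) : ℝ)) :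
    ∃ (pp : Nat.Primes) (_ : 2 < (pp : ℕ)) (i : Fin (thetaIndex (pilotDataOfK D K)).lstar)
        (x₀ : (thetaIndex (pilotDataOfK D K)).Fibre (.inr pp)),
      haveI : Fact (pp : ℕ).Prime := ⟨pp.2⟩
      placeOf (pilotDataOfK D K) pp.1 x₀ ∈ (pilotDataOfK D K).S ∧
      ((pp : ℕ) : ℝ) ^ ((((i : ℕ) : ℝ) + 2) * (4 + 2 * Real.logb (pp : ℕ) (Module.finrank ℚ K)) + 1) *
        (((pp : ℕ) : ℝ) ^ ((ord K (placeOf (pilotDataOfK D K) pp.1 x₀) (algebraMap F K E.j) : ℝ) /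
          (2 * l * ramIdx K (placeOf (pilotDataOfK D K) pp.1 x₀)))) ^ (((i : ℕ) + 1) ^ 2 - 1) < 1 := by
  obtain ⟨pp, hp2, x₀, hS, hgt⟩ := h
  haveI : Fact (pp : ℕ).Prime := ⟨pp.2⟩
  have hp1 : (1 : ℝ) < ((pp : ℕ) : ℝ) := by exact_mod_cast pp.2.one_lt
  have h2 : 2 ≤ (pilotDataOfK D K).lstar := (pilotDataOfK D K).two_le_lstar
  have htop : (pilotDataOfK D K).lstar - 1 < (thetaIndex (pilotDataOfK D K)).lstar := by
    show (pilotDataOfK D K).lstar - 1 < (pilotDataOfK D K).lstar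
    omega
  refine ⟨pp, hp2, ⟨(pilotDataOfK D K).lstar - 1, htop⟩, x₀, hS, ?_⟩
  rw [Summit.ABC.IUTFork.Repair.RHPlaceCutHeightCeiling.deepCell_iff_height_gt D pp ⟨(pilotDataOfK D K).lstar - 1, htop⟩ x₀]
  have hc : (((⟨(pilotDataOfK D K).lstar - 1, htop⟩ : Fin (thetaIndex (pilotDataOfK D K)).lstar) : ℕ) : ℝ) =
      ((pilotDataOfK D K).lstar : ℝ) - 1 := by
    rw [Fin.val_mk, Nat.cast_sub (by omega : 1 ≤ (pilotDataOfK D K).lstar), Nat.cast_one]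
  rw [hc]
  -- `log_p[K:ℚ] ≤ log_p N₁`, and `2l·e > 0`
  have hN1 : (1 : ℝ) ≤ (Module.finrank ℚ K : ℝ) := by exact_mod_cast Module.finrank_pos
  have hL : Real.logb (pp : ℕ) (Module.finrank ℚ K) ≤ Real.logb (pp : ℕ) N₁ :=
    Real.logb_le_logb_of_le hp1 (by linarith) hN
  have hl0 : (0 : ℝ) < (l : ℝ) := by exact_mod_cast lt_of_lt_of_le (by norm_num) D.five_le_l
  have he : (0 : ℝ) < (ramIdx K (placeOf (pilotDataOfK D K) pp.1 x₀) : ℝ) := by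
    exact_mod_cast Nat.pos_of_ne_zero (ramIdx_ne_zero K _)
  have hm1 : (0 : ℝ) ≤ ((pilotDataOfK D K).lstar : ℝ) := Nat.cast_nonneg _
  have hmono : (2 * l * ramIdx K (placeOf (pilotDataOfK D K) pp.1 x₀) : ℝ) *
        ((((pilotDataOfK D K).lstar : ℝ) - 1 + 2) * (4 + 2 * Real.logb (pp : ℕ) (Module.finrank ℚ K)) + 1) ≤
      (2 * l * ramIdx K (placeOf (pilotDataOfK D K) pp.1 x₀) : ℝ) *
        ((((pilotDataOfK D K).lstar : ℝ) + 1) * (4 + 2 * Real.logb (pp : ℕ) N₁) + 1) := by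
    apply mul_le_mul_of_nonneg_left _ (by positivity)
    nlinarith
  have hsq : ((((pilotDataOfK D K).lstar : ℝ) - 1 + 1) ^ 2 - 1) = ((((pilotDataOfK D K).lstar : ℝ)) ^ 2 - 1) := by ring
  rw [hsq]
  exact lt_of_le_of_lt hmono hgt

/-- Chosen-q-idele form of `deepOrd_of_topLabel_gt_logb`: the strict top-label inequality with a certified `N₁ ≥ [K:ℚ]` at some bad `x₀ ∣ p > 2`
puts the datum ON the depth locus of the v8K/v10K certificates (so `hNumBad`, not `hSHwBad`, is the binder that bites there).
[claim: Mochizuki2012, status: disputed] [cite: DupuyHilado2025, §3.4] -/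
theorem GenuineK.deep_of_topLabel_gt_logb {N₁ : ℝ} (hN : (Module.finrank ℚ K : ℝ) ≤ N₁)
    (h : ∃ (pp : Nat.Primes) (_ : 2 < (pp : ℕ)) (x₀ : (thetaIndex (pilotDataOfK D K)).Fibre (.inr pp)),
      haveI : Fact (pp : ℕ).Prime := ⟨pp.2⟩
      placeOf (pilotDataOfK D K) pp.1 x₀ ∈ (pilotDataOfK D K).S ∧
        (2 * l * ramIdx K (placeOf (pilotDataOfK D K) pp.1 x₀) : ℝ) *
            ((((pilotDataOfK D K).lstar : ℝ) + 1) * (4 + 2 * Real.logb (pp : ℕ) N₁) + 1) <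
          ((((pilotDataOfK D K).lstar : ℝ)) ^ 2 - 1) * -((ord K (placeOf (pilotDataOfK D K) pp.1 x₀) (algebraMap F K E.j) : ℤ) : ℝ)) :
    ∃ (pp : Nat.Primes) (_ : 2 < (pp : ℕ)) (i : Fin (thetaIndex (pilotDataOfK D K)).lstar)
        (x₀ : (thetaIndex (pilotDataOfK D K)).Fibre (.inr pp)),
      haveI : Fact (pp : ℕ).Prime := ⟨pp.2⟩
      ((pp : ℕ) : ℝ) ^ ((((i : ℕ) : ℝ) + 2) * (4 + 2 * Real.logb (pp : ℕ) (Module.finrank ℚ K)) + 1) *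
        ‖(exists_realising_qIdeles_pilotDataOfK D).choose pp x₀‖ ^ (((i : ℕ) + 1) ^ 2 - 1) < 1 :=
  (GenuineK.deep_iff_deepOrd D).mpr (GenuineK.deepOrd_of_topLabel_gt_logb D hN h)

end Summit.ABC.IUTFork.Conditional

end
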